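import Summits.AtomisticToContinuum.Crystallization.Theorems.OverbindingBudgetAffineCompressedCutInnerA
import Summits.AtomisticToContinuum.Crystallization.Theorems.ThreeConeCertificateOnePercentCertificateFccRung

/-!
# `OverbindingBudget` / crux `RobustDefectLimitWindows` (stmt-AtomisticToContinuum-31280) — «Inner»: THE LEAF `NearFieldSlackMinSecond 12 (1/25)`

Closing file of lens-4's residual programme (iii) «CompressedCut» (plan «Inner» I4).  At a priced, `(12, 10⁻⁴, 10⁻³)`-affinely deep site `i` with
`ν = nn_i < 17/20`:

* ★ `inner_sum_ge` — the INNER-BALL ESTIMATE `12·(t₀²/24 − t₀/12) − (B/6)·ν⁻⁶ ≤ ∑_{d ≤ 106/25·ν} min (½V) V`, `t₀ = (1.0011ν)⁻⁶`, `B = 2.435912`: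
  the twelve registered first-shell neighbours (`ν ≤ d ≤ 1.0011ν`, «InnerA» §1–2) give `≥ 12·(t₀²/24 − t₀/12)`; `i` itself gives `0`; every other
  inner site `m` is labelled by the layer-rigidity record («Frame».`charts_of_affDeepReg`, «Reading».`layer_rigidity_record`) and contributes
  `≥ −d⁻⁶/6 ≥ −ν⁻⁶·t(m)/(6·10⁶)` («InnerS».`site_bound`), with `Σ t(m) ≤ 2435912` («InnerA».`table_total`, tables of «InnerT»);
* ★★ `nearFieldSlackSecondAt_record`, ★★★ `nearFieldSlackMinSecond_record : NearFieldSlackMinSecond 12 (1/25)` — with the outer bookkeeping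
  «Outer».`inner_sub_tail_le_nearLoad` (`− (197/3000)ν⁻⁶ ≤ nearLoad − inner sum`) and the floor `e⋆ ≤ −0.711` (`OnePercentFccRung.eStar_le_neg`):
  `c = 1/100`, certificate `Q(u) = ½(0.9934u)² − 1.505052u + 0.701 ≥ 0.177` on `u = ν⁻⁶ ≥ 2.65`;
* `compressedRun_record : CompressedRun` («First».`compressedRun_of_nearFieldSlackMinSecond`).
[this file: statements + proofs; no new definitions]
-/

namespace Summit.AtomisticToContinuum.Crystallization.Theorems.OverbindingBudgetAffineCompressedCutInner

open scoped BigOperators Classical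
open Literature.MathematicalPhysics.StatisticalMechanics
open Literature.Geometry.DiscreteGeometry (nearestDist nearestDist_nonneg nearestDist_le_dist)
open Summit.AtomisticToContinuum.Crystallization.Theorems.OverbindingBudgetAffineLadder (AffDeepReg)
open Summit.AtomisticToContinuum.Crystallization.Theorems.OverbindingBudgetAffineRunCut (CompressedRun)
open Summit.AtomisticToContinuum.Crystallization.Theorems.OverbindingBudgetAffineCompressedCut (Priced nearLoad NearFieldSlackSecondAt NearFieldSlackMinSecond
  compressedRun_of_nearFieldSlackMinSecond nearestDist_pos_of_priced)
open Summit.AtomisticToContinuum.Crystallization.Theorems.OverbindingBudgetAffineCompressedCutKernel (T3 tsub tadd)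
open Summit.AtomisticToContinuum.Crystallization.Theorems.OverbindingBudgetAffineCompressedCutCharts (mv)
open Summit.AtomisticToContinuum.Crystallization.Theorems.OverbindingBudgetAffineCompressedCutSeed (InLayer inLayer_tsub)
open Summit.AtomisticToContinuum.Crystallization.Theorems.OverbindingBudgetAffineCompressedCutBudget (tauR dR)
open Summit.AtomisticToContinuum.Crystallization.Theorems.OverbindingBudgetAffineCompressedCutEstablishTwo (flipIso lower_flip)
open Summit.AtomisticToContinuum.Crystallization.Theorems.OverbindingBudgetAffineCompressedCutStepA (upper_flip)
open Summit.AtomisticToContinuum.Crystallization.Theorems.OverbindingBudgetAffineCompressedCutFrame (charts_of_affDeepReg)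
open Summit.AtomisticToContinuum.Crystallization.Theorems.OverbindingBudgetAffineCompressedCutReading (layer_rigidity_record)
open Summit.AtomisticToContinuum.Crystallization.Theorems.OverbindingBudgetAffineCompressedCutSharpC (seed_flip)
open Summit.AtomisticToContinuum.Crystallization.Theorems.OverbindingBudgetAffineCompressedCutOuter (inner_sub_tail_le_nearLoad)
open Summit.AtomisticToContinuum.Crystallization.Theorems.OverbindingBudgetAffineCompressedCutInnerT (tOfE eOf)
open Summit.AtomisticToContinuum.Crystallization.Theorems.OverbindingBudgetAffineCompressedCutInnerS (site_bound)
open Summit.AtomisticToContinuum.Crystallization.Theorems.OverbindingBudgetAffineCompressedCutInnerA (t0_window first_shell_value first_shell_dist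
  twelve_le_card table_total)
open Summit.AtomisticToContinuum.Crystallization.Theorems.OnePercentFccRung (eStar_le_neg)

variable {N : ℕ}

/-- The central and defect contributions are `≥ −d⁻⁶/6` (and the centre `0`). [this file] -/
theorem min_half_ge {d : ℝ} (hd : 0 < d) : -(1 / 6 * d⁻¹ ^ 6) ≤ min (1 / 2 * lennardJones d) (lennardJones d) := by
  have h := neg_le_lennardJones_of_le hd le_rfl
  have h0 : 0 ≤ d⁻¹ ^ 6 := by positivity
  exact le_min (by linarith) (by linarith)

/-- ★ **THE INNER-BALL ESTIMATE** (see the module docstring). [this file] -/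
theorem inner_sum_ge {y : Fin N → EuclideanSpace ℝ (Fin 3)} (hy : Function.Injective y) {i : Fin N} (hν : 0 < nearestDist y i)
    (hν1 : nearestDist y i < 17 / 20) (hreg : AffDeepReg 12 (1 / 10 ^ 4) (1 / 1000) (1 / 450) y i) :
    12 * (((10011 / 10000 * nearestDist y i)⁻¹ ^ 6) ^ 2 / 24 - (10011 / 10000 * nearestDist y i)⁻¹ ^ 6 / 12)
        - 1 / 6 * (nearestDist y i)⁻¹ ^ 6 * (2435912 / 10 ^ 6)
      ≤ ∑ k ∈ Finset.univ.filter (fun k => dist (y i) (y k) ≤ 106 / 25 * nearestDist y i),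
          min (1 / 2 * lennardJones (dist (y i) (y k))) (lennardJones (dist (y i) (y k))) := by
  obtain ⟨A, Qf, P, f, hP, hA, hf, hinj, hex, hBlo, hBup⟩ := charts_of_affDeepReg hreg
  obtain ⟨s, hs, ref, Cz, e, hRec1, hRec2, ⟨x₀, hx₀L, hx₀⟩, hRec4, hRec5, -⟩ := layer_rigidity_record hy hν hP hA hf hinj hex hBlo hBup
  have hB := lower_flip hs hBlo
  have hB' := upper_flip hBup hs
  have hii : dist (y i) (y i) ≤ 12 * nearestDist y i := by rw [dist_self]; positivity
  have hseed := seed_flip (y := y) (A := A) (hP i hii) hs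
  -- the labels of the inner sites (clause 4, by choice)
  have key : ∀ m : Fin N, ∃ (ℓ : ℤ) (x : T3), dist (y m) (y i) ≤ 106 / 25 * nearestDist y i → (-5 ≤ ℓ ∧ ℓ ≤ 5 ∧ InLayer x ∧
      ‖y m - y i - ((nearestDist y i • A i) ∘ₗ (flipIso s hs).toLinearMap) (mv (tadd (ref ℓ) x))‖ ≤
        dR (nearestDist y i) 31 + 1 / 10 ^ 4 * (10347 / 10000 * nearestDist y i) + tauR (nearestDist y i) 31 ∧
      9967 / 10000 * (9026 / 10000 * nearestDist y i) ≤ nearestDist y m) := by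
    intro m
    by_cases h : dist (y m) (y i) ≤ 106 / 25 * nearestDist y i
    · obtain ⟨ℓ, x, h1, h2, h3, h4, h5⟩ := hRec4 m h
      exact ⟨ℓ, x, fun _ => ⟨h1, h2, h3, h4, h5⟩⟩
    · exact ⟨0, (0, 0, 0), fun h' => absurd h' h⟩
  choose L X hLX using key
  -- the inner ball, its registered first shell `S₁`, the rest `R`
  set Inner := Finset.univ.filter (fun k => dist (y i) (y k) ≤ 106 / 25 * nearestDist y i) with hInner
  have hS : ∀ k, (∃ v ∈ P i, ‖v‖ = 1 ∧ f i v = y k) → k ∈ Inner.filter (fun k => ∃ v ∈ P i, ‖v‖ = 1 ∧ f i v = y k) := by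
    rintro k ⟨v, hv, h1, hk⟩
    obtain ⟨-, -, hd⟩ := first_shell_dist hν hA hf hv h1 hk
    refine Finset.mem_filter.2 ⟨Finset.mem_filter.2 ⟨Finset.mem_univ _, by linarith⟩, v, hv, h1, hk⟩
  have h12 := twelve_le_card hν hP hf hinj _ hS
  obtain ⟨ht2, -⟩ := t0_window hν hν1
  -- (1) the registered first shell
  have hval : ∀ k ∈ Inner.filter (fun k => ∃ v ∈ P i, ‖v‖ = 1 ∧ f i v = y k),
      ((10011 / 10000 * nearestDist y i)⁻¹ ^ 6) ^ 2 / 24 - (10011 / 10000 * nearestDist y i)⁻¹ ^ 6 / 12 ≤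
        min (1 / 2 * lennardJones (dist (y i) (y k))) (lennardJones (dist (y i) (y k))) := by
    intro k hk
    obtain ⟨-, v, hv, h1, hfk⟩ := Finset.mem_filter.1 hk
    obtain ⟨-, hlo, hhi⟩ := first_shell_dist hν hA hf hv h1 hfk
    exact first_shell_value hν hν1 hlo hhi
  have hpart1 : 12 * (((10011 / 10000 * nearestDist y i)⁻¹ ^ 6) ^ 2 / 24 - (10011 / 10000 * nearestDist y i)⁻¹ ^ 6 / 12) ≤
      ∑ k ∈ Inner.filter (fun k => ∃ v ∈ P i, ‖v‖ = 1 ∧ f i v = y k),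
        min (1 / 2 * lennardJones (dist (y i) (y k))) (lennardJones (dist (y i) (y k))) := by
    have h := Finset.card_nsmul_le_sum _ _ _ hval
    rw [nsmul_eq_mul] at h
    have hψ : 0 ≤ ((10011 / 10000 * nearestDist y i)⁻¹ ^ 6) ^ 2 / 24 - (10011 / 10000 * nearestDist y i)⁻¹ ^ 6 / 12 := by
      nlinarith [ht2]
    have h12r : (12 : ℝ) ≤ (Inner.filter (fun k => ∃ v ∈ P i, ‖v‖ = 1 ∧ f i v = y k)).card := by exact_mod_cast h12
    nlinarith [h, hψ, h12r]
  -- (2) the rest: the centre and the labelled defects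
  have hiR : i ∈ Inner.filter (fun k => ¬ ∃ v ∈ P i, ‖v‖ = 1 ∧ f i v = y k) := by
    refine Finset.mem_filter.2 ⟨Finset.mem_filter.2 ⟨Finset.mem_univ _, by rw [dist_self]; positivity⟩, ?_⟩
    rintro ⟨v, hv, h1, hk⟩
    exact (first_shell_dist hν hA hf hv h1 hk).1 rfl
  have hgi : min (1 / 2 * lennardJones (dist (y i) (y i))) (lennardJones (dist (y i) (y i))) = 0 := by
    rw [dist_self, lennardJones_zero, mul_zero, min_self]
  have hR : ∀ m ∈ (Inner.filter (fun k => ¬ ∃ v ∈ P i, ‖v‖ = 1 ∧ f i v = y k)).erase i,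
      m ≠ i ∧ dist (y m) (y i) ≤ 106 / 25 * nearestDist y i ∧ (∀ v ∈ P i, ‖v‖ = 1 → f i v ≠ y m) ∧
      -5 ≤ L m ∧ L m ≤ 5 ∧ InLayer (X m) ∧
      ‖y m - y i - ((nearestDist y i • A i) ∘ₗ (flipIso s hs).toLinearMap) (mv (tadd (ref (L m)) (X m)))‖ ≤
        dR (nearestDist y i) 31 + 1 / 10 ^ 4 * (10347 / 10000 * nearestDist y i) + tauR (nearestDist y i) 31 ∧
      9967 / 10000 * (9026 / 10000 * nearestDist y i) ≤ nearestDist y m := by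
    intro m hm
    obtain ⟨hmi, hmR⟩ := Finset.mem_erase.1 hm
    obtain ⟨hmI, hnot⟩ := Finset.mem_filter.1 hmR
    have hdm : dist (y m) (y i) ≤ 106 / 25 * nearestDist y i := by rw [dist_comm]; exact (Finset.mem_filter.1 hmI).2
    exact ⟨hmi, hdm, fun v hv h1 hfv => hnot ⟨v, hv, h1, hfv⟩, hLX m hdm⟩
  have hsite : ∀ m ∈ (Inner.filter (fun k => ¬ ∃ v ∈ P i, ‖v‖ = 1 ∧ f i v = y k)).erase i,
      -(1 / 6 * (nearestDist y i)⁻¹ ^ 6 *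
        ((tOfE (eOf (L m) ((tadd (ref (L m)) x₀).1 - 2 * L m) ((tsub (X m) x₀).1 / 3) ((tsub (X m) x₀).2.1 / 3)) : ℝ) / 10 ^ 6)) ≤
        min (1 / 2 * lennardJones (dist (y i) (y m))) (lennardJones (dist (y i) (y m))) := by
    intro m hm
    obtain ⟨hmi, hdm, hnot, hℓ1, hℓ2, hx, hread, -⟩ := hR m hm
    have hw := inLayer_tsub hx hx₀L
    obtain ⟨-, -, -, hbd⟩ := site_bound hy hν hP hA hf hinj hex hB hB' hseed hRec1 hRec2 hx₀L hx₀ hRec5 hmi hdm hnot hℓ1 hℓ2 hx hread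
      (σ := (tadd (ref (L m)) x₀).1 - 2 * L m) (by ring) (Int.mul_ediv_cancel' hw.2.1).symm (Int.mul_ediv_cancel' hw.2.2).symm
    have hd : 0 < dist (y i) (y m) := dist_pos.2 fun h => hmi (hy h).symm
    have h0 : 0 ≤ (nearestDist y i)⁻¹ ^ 6 := by positivity
    exact le_trans (by nlinarith [hbd, h0]) (min_half_ge hd)
  have htot := table_total hy hν hP hA hf hinj hex hB hB' hseed hRec1 hRec2 hx₀L hx₀ hRec5 _ hR
  have htotR : ∑ m ∈ (Inner.filter (fun k => ¬ ∃ v ∈ P i, ‖v‖ = 1 ∧ f i v = y k)).erase i,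
      ((tOfE (eOf (L m) ((tadd (ref (L m)) x₀).1 - 2 * L m) ((tsub (X m) x₀).1 / 3) ((tsub (X m) x₀).2.1 / 3)) : ℝ)) ≤ 2435912 := by
    exact_mod_cast htot
  have hpart2 : -(1 / 6 * (nearestDist y i)⁻¹ ^ 6 * (2435912 / 10 ^ 6)) ≤
      ∑ m ∈ (Inner.filter (fun k => ¬ ∃ v ∈ P i, ‖v‖ = 1 ∧ f i v = y k)).erase i,
        min (1 / 2 * lennardJones (dist (y i) (y m))) (lennardJones (dist (y i) (y m))) := by
    refine le_trans ?_ (Finset.sum_le_sum hsite)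
    rw [Finset.sum_neg_distrib, ← Finset.mul_sum, ← Finset.sum_div, neg_le_neg_iff]
    have h0 : 0 ≤ 1 / 6 * (nearestDist y i)⁻¹ ^ 6 := by positivity
    exact mul_le_mul_of_nonneg_left (div_le_div_of_nonneg_right htotR (by positivity)) h0
  -- assembly
  rw [← Finset.sum_filter_add_sum_filter_not Inner (fun k => ∃ v ∈ P i, ‖v‖ = 1 ∧ f i v = y k),
    ← Finset.add_sum_erase _ _ hiR, hgi]
  linarith [hpart1, hpart2]

/-- ★★ **THE SECOND-CLASS NEAR LAW, every window `δ > 0`**, with `c = 1/100`. [this file] -/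
theorem nearFieldSlackSecondAt_record {δ : ℝ} (hδ : 0 < δ) :
    NearFieldSlackSecondAt 64 12 (1 / 10 ^ 4) (1 / 1000) (17 / 50) (17 / 20) (3 / 50) (1 / 450) δ 12 (1 / 25) := by
  refine ⟨1 / 100, by norm_num, ?_⟩
  intro N y hy i hi hreg
  obtain ⟨hreg, hν1⟩ := hreg
  have hν : 0 < nearestDist y i := nearestDist_pos_of_priced hδ hi
  have hO := inner_sub_tail_le_nearLoad hδ hy hi hreg
  have hI := inner_sum_ge hy hν hν1 hreg
  have he : (⨅ Q : PeriodicConfiguration 3, Q.energyPerParticle lennardJones) ≤ -(711 / 1000 : ℝ) := eStar_le_neg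
  obtain ⟨ht2, ht⟩ := t0_window hν hν1
  have hu : 265 / 100 ≤ (nearestDist y i)⁻¹ ^ 6 := by
    have h1 : 20 / 17 ≤ (nearestDist y i)⁻¹ := by
      rw [le_inv_comm₀ (by norm_num) hν]
      linarith
    calc (265 / 100 : ℝ) ≤ (20 / 17) ^ 6 := by norm_num
      _ ≤ (nearestDist y i)⁻¹ ^ 6 := pow_le_pow_left₀ (by norm_num) h1 6
  have h1 : (9934 / 10000 * (nearestDist y i)⁻¹ ^ 6) ^ 2 / 2 - 9934 / 10000 * (nearestDist y i)⁻¹ ^ 6 ≤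
      ((10011 / 10000 * nearestDist y i)⁻¹ ^ 6) ^ 2 / 2 - (10011 / 10000 * nearestDist y i)⁻¹ ^ 6 := by
    nlinarith [mul_nonneg (sub_nonneg.2 ht)
      (by linarith : (0 : ℝ) ≤ (10011 / 10000 * nearestDist y i)⁻¹ ^ 6 + 9934 / 10000 * (nearestDist y i)⁻¹ ^ 6 - 2)]
  have h2 : 0 ≤ 24671089 / 50000000 * ((nearestDist y i)⁻¹ ^ 6) ^ 2 - 376263 / 250000 * (nearestDist y i)⁻¹ ^ 6 + 701 / 1000 := by
    nlinarith [sq_nonneg ((nearestDist y i)⁻¹ ^ 6 - 265 / 100), hu]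
  linarith [hO, hI, he, h1, h2]

/-- ★★★ **THE LEAF `NearFieldSlackMinSecond 12 (1/25)`** of «CompressedCut» — the affine second class of the economical near-field law, all windows. [this file] -/
theorem nearFieldSlackMinSecond_record : NearFieldSlackMinSecond 12 (1 / 25) :=
  fun _ hδ _ => nearFieldSlackSecondAt_record hδ

/-- **`CompressedRun`** — the run-optimal economical-cut programme, now unconditional («First».`compressedRun_of_nearFieldSlackMinSecond`). [this file] -/
theorem compressedRun_record : CompressedRun :=
  compressedRun_of_nearFieldSlackMinSecond nearFieldSlackMinSecond_record

end Summit.AtomisticToContinuum.Crystallization.Theorems.OverbindingBudgetAffineCompressedCutInner
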